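import Summits.QuantumFields.YangMills.Theorems.ColdStartUniversalityLatticeLangevinLawUnique
import HarnessLib

/-!
# Route `ColdStartUniversality` (rung input (E3) groundwork, crux K_A1 stmt-QuantumFields-24809): uniqueness in law
# from EVERY deterministic start — the transition laws of the SU(2) lattice Langevin dynamics are well defined

Helper file (seat `ym-line-csu-p1`).  `lawUnique_of_start`: for every initial configuration `U₀ ∈ SU(2)^E`, any two
solutions of the Shen–Zhu–Zhu system started at `U₀`, on any two probability spaces (in `Type`) with flat Brownian
drivers, have the same one-time laws (same proof as the cold-start case `coldStart_lawUnique`: canonical space of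
continuous paths, `isFlatBrownian_canonical`, `map_pathMap_eq`, `solution_from_start`, `isSolution_comp`,
`latticeLangevin_pathwise_unique`).  Consequently the family of transition laws `P_t(U₀, ·) := law(U^{U₀}_t)` of SZZ
§3 («`(P_t^L f)(x) = 𝔼 f(Q(t,x))`») is WELL DEFINED — independent of the probability space, the Brownian motion and
the solution chosen — which is what the Markov-semigroup formulation of the open input (E3) (Cesàro ergodicity)
presupposes.  No definition, no sorry.  RECORD-rung R3 plumbing; nothing here bears on the mass gap. -/

set_option autoImplicit false

noncomputable section

namespace Summit.QuantumFields.YangMills.Theorems.ColdStartUniversality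

open MeasureTheory ProbabilityTheory Filter Topology
open scoped NNReal ENNReal BigOperators
open Literature.Probability.Process Literature.Analysis.FunctionSpaces
open Literature.MathematicalPhysics.QuantumFieldTheory
open Literature.MathematicalPhysics.QuantumLattice (fundamentalRep fundamentalLatticeRep)

/-- **Uniqueness in law from every deterministic start** (SZZ Lemma 3.2 + Revuz–Yor IX (1.7)): two solutions of
the SU(2) SZZ system on `(ℤ/L)³` at coupling `β'` started at the same configuration `U₀`, on any two probability
spaces with flat Brownian drivers, have the same law at every lattice time. [cite: RevuzYor1999, Ch. IX Thm (1.7)] -/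
theorem lawUnique_of_start {L : ℕ} [NeZero L] (β' : ℝ)
    (U₀ : GaugeConfig 3 L (Matrix.specialUnitaryGroup (Fin 2) ℂ))
    {Ω : Type} {mΩ : MeasurableSpace Ω} {P : Measure Ω} [IsProbabilityMeasure P]
    {W : ℝ≥0 → Ω → (Edge 3 L × NoiseIdx 2 → ℝ)} (hW : IsFlatBrownian W P)
    {U : ℝ≥0 → Ω → GaugeConfig 3 L (Matrix.specialUnitaryGroup (Fin 2) ℂ)}
    {Ω' : Type} {mΩ' : MeasurableSpace Ω'} {P' : Measure Ω'} [IsProbabilityMeasure P']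
    {W' : ℝ≥0 → Ω' → (Edge 3 L × NoiseIdx 2 → ℝ)} (hW' : IsFlatBrownian W' P')
    {U' : ℝ≥0 → Ω' → GaugeConfig 3 L (Matrix.specialUnitaryGroup (Fin 2) ℂ)}
    (hU0 : ∀ ω, U 0 ω = U₀)
    (hU : (latticeLangevinDynamics (fundamentalLatticeRep 2) β').IsSolution (fundamentalRep (Fin 2))
      hW.natFiltration P W U)
    (hU'0 : ∀ ω, U' 0 ω = U₀)
    (hU' : (latticeLangevinDynamics (fundamentalLatticeRep 2) β').IsSolution (fundamentalRep (Fin 2))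
      hW'.natFiltration P' W' U') (t : ℝ≥0) :
    Measure.map (U t) P = Measure.map (U' t) P' := by
  have hφ := measurable_pathMap hW
  have hφ' := measurable_pathMap hW'
  set Pc := P.map (fun ω => (⟨fun t => W t ω, continuous_path_and_zero hW ω⟩ :
      {p : ℝ≥0 → (Edge 3 L × NoiseIdx 2 → ℝ) // Continuous p ∧ p 0 = 0})) with hPc
  haveI hPcP : IsProbabilityMeasure Pc := Measure.isProbabilityMeasure_map hφ.aemeasurable
  have hWc := isFlatBrownian_canonical hW
  have hmap' : P'.map (fun ω => (⟨fun t => W' t ω, continuous_path_and_zero hW' ω⟩ :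
      {p : ℝ≥0 → (Edge 3 L × NoiseIdx 2 → ℝ) // Continuous p ∧ p 0 = 0})) = Pc :=
    (map_pathMap_eq hW hW').symm
  obtain ⟨Uc, hUc0, hUc⟩ := solution_from_start hWc β' U₀
  have hsol : (latticeLangevinDynamics (fundamentalLatticeRep 2) β').IsSolution (fundamentalRep (Fin 2))
      hW.natFiltration P W (fun s ω => Uc s ⟨fun t => W t ω, continuous_path_and_zero hW ω⟩) :=
    isSolution_comp hW hWc hφ rfl (fun _ _ => rfl) β' hUc
  have hsol' : (latticeLangevinDynamics (fundamentalLatticeRep 2) β').IsSolution (fundamentalRep (Fin 2))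
      hW'.natFiltration P' W' (fun s ω => Uc s ⟨fun t => W' t ω, continuous_path_and_zero hW' ω⟩) :=
    isSolution_comp hW' hWc hφ' hmap' (fun _ _ => rfl) β' hUc
  have hUeq := latticeLangevin_pathwise_unique hW β' U₀ hU0 (fun ω => hUc0 _) hU hsol
  have hU'eq := latticeLangevin_pathwise_unique hW' β' U₀ hU'0 (fun ω => hUc0 _) hU' hsol'
  have hmUc : Measurable (Uc t) := (hUc.adapted t).mono (hWc.natFiltration.le t) le_rfl
  calc Measure.map (U t) P
      = Measure.map (fun ω => Uc t ⟨fun t => W t ω, continuous_path_and_zero hW ω⟩) P :=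
        Measure.map_congr (hUeq.mono fun ω hω => hω t)
    _ = Pc.map (Uc t) := by rw [hPc, Measure.map_map hmUc hφ]; rfl
    _ = Measure.map (fun ω => Uc t ⟨fun t => W' t ω, continuous_path_and_zero hW' ω⟩) P' := by
        rw [← hmap', Measure.map_map hmUc hφ']; rfl
    _ = Measure.map (U' t) P' := Measure.map_congr (hU'eq.mono fun ω hω => (hω t).symm)

/-- **The transition laws are realised on one fixed space**: for every start `U₀` and every solution `U` from
`U₀` on any space, `law(U_t)` equals the law of the canonical solution from `U₀` on the product Wiener space of
`coldStart_solution`'s construction — i.e. `P_t(U₀, ·)` can be computed in any realisation. [folklore] -/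
theorem map_eq_map_of_solution_piWiener {L : ℕ} [NeZero L] (β' : ℝ)
    (U₀ : GaugeConfig 3 L (Matrix.specialUnitaryGroup (Fin 2) ℂ))
    {Ω : Type} {mΩ : MeasurableSpace Ω} {P : Measure Ω} [IsProbabilityMeasure P]
    {W : ℝ≥0 → Ω → (Edge 3 L × NoiseIdx 2 → ℝ)} (hW : IsFlatBrownian W P)
    {U : ℝ≥0 → Ω → GaugeConfig 3 L (Matrix.specialUnitaryGroup (Fin 2) ℂ)}
    (hU0 : ∀ ω, U 0 ω = U₀)
    (hU : (latticeLangevinDynamics (fundamentalLatticeRep 2) β').IsSolution (fundamentalRep (Fin 2))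
      hW.natFiltration P W U)
    {V : ℝ≥0 → ((Edge 3 L × NoiseIdx 2) → (ℝ≥0 → ℝ)) → GaugeConfig 3 L (Matrix.specialUnitaryGroup (Fin 2) ℂ)}
    (hV0 : ∀ ω, V 0 ω = U₀)
    (hV : (latticeLangevinDynamics (fundamentalLatticeRep 2) β').IsSolution (fundamentalRep (Fin 2))
      (isFlatBrownian_piWiener 3 L (NoiseIdx 2)).natFiltration
      (Measure.pi fun _ : Edge 3 L × NoiseIdx 2 => preWienerMeasure)
      (fun (t : ℝ≥0) (ω : (Edge 3 L × NoiseIdx 2) → (ℝ≥0 → ℝ)) (i : Edge 3 L × NoiseIdx 2) => brownian t (ω i)) V)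
    (t : ℝ≥0) :
    Measure.map (U t) P = Measure.map (V t) (Measure.pi fun _ : Edge 3 L × NoiseIdx 2 => preWienerMeasure) := by
  haveI := isProbabilityMeasure_piWiener (Edge 3 L × NoiseIdx 2)
  exact lawUnique_of_start β' U₀ hW (isFlatBrownian_piWiener 3 L (NoiseIdx 2)) hU0 hU hV0 hV t

end Summit.QuantumFields.YangMills.Theorems.ColdStartUniversality

end
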